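import Literature.MathematicalPhysics.QuantumLattice.HubbardRectangularTorus
import Literature.MathematicalPhysics.QuantumLattice.HubbardRingGroundStateContinuityProofs
import HarnessLib

/-!
# Tiling and filling inequalities for the Hubbard ground-state energies on two-dimensional tori

Trunk T-QLATTICE (family `hubbard`); continuation of `HubbardRectangularTorus.lean` (the major cut
`groundEnergyAt_rect_cut` of a rectangular fermionic torus `ℤ/aℤ × ℤ/bℤ`, swap invariance) towards
the thermodynamic limit of the sector ground-state energies `E_{L×L}(N) = groundEnergyAt
(fermionRectTorusGraph L L) t U N` of the Hubbard model (support item `TwPureThermalBound` of the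
route `HubbardSuperconductivity/ThermalWedge`). Subadditivity à la Ruelle, in the three shapes the
Fekete argument along squares consumes:

* a priori bounds: every site of `ℤ/aℤ × ℤ/bℤ` has `≤ 4` neighbours
  (`card_filter_fermionRectTorusGraph_adj_le`), so there are `≤ 4ab` ordered bonds and, for
  `U ≥ 0`, `-8|t| ab ≤ E_{a×b}(N) ≤ (8|t| + U) ab` (`groundEnergyAt_rect_mem_Icc`; the general
  graph form is `groundEnergyAt_mem_Icc`);
* **tiling** (`groundEnergyAt_rect_strip`, `groundEnergyAt_square_tiling`): cutting
  `ℤ/(k+1)Mℤ × ℤ/(k+1)Mℤ` into `(k+1)²` blocks `ℤ/Mℤ × ℤ/Mℤ` with arbitrary block particle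
  numbers `N_{ij} ≤ 2M²`,
  `E_{(k+1)M}(Σ N_{ij}) ≤ Σ E_M(N_{ij}) + 16|t| M k (k+1)` (strips in the major direction at
  `8|t|·side` per cut, the coordinate swap, strips again);
* **filling** (`groundEnergyAt_square_fill`): for `U ≥ 0`,
  `E_{ℓ+r}(N + N_B) ≤ E_ℓ(N) + (8|t| + U)((ℓ+r)² - ℓ²) + 8|t|(2ℓ + r)` for any number
  `N_B ≤ 2((ℓ+r)² - ℓ²)` of particles put into the two complementary rectangles.

Everything is proved; no definition. [folklore]

## Sources

D. Ruelle, *Statistical Mechanics: Rigorous Results* (Benjamin, 1969), §2.2 (van Hove sequences of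
boxes, subadditivity of the ground-state / free energy) and §3.3.
-/

noncomputable section

open Matrix Finset
open scoped ComplexOrder BigOperators

namespace Literature.MathematicalPhysics.QuantumLattice

namespace ThermodynamicLimit

/-! ### A priori bounds on rectangular tori -/

/-- Every site of `ℤ/aℤ × ℤ/bℤ` has at most four neighbours. [folklore] -/
theorem card_filter_fermionRectTorusGraph_adj_le (a b : ℕ) (p : Fin a ×ₗ Fin b) :
    #{q | (fermionRectTorusGraph a b).Adj p q} ≤ 4 := by
  set x : ℕ := ((ofLex p).1 : ℕ) with hx
  set y : ℕ := ((ofLex p).2 : ℕ) with hy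
  calc #{q | (fermionRectTorusGraph a b).Adj p q}
      ≤ #({((x + 1) % a, y), ((x + (a - 1)) % a, y), (x, (y + 1) % b), (x, (y + (b - 1)) % b)} :
          Finset (ℕ × ℕ)) := by
        refine Finset.card_le_card_of_injOn (fun q => (((ofLex q).1 : ℕ), ((ofLex q).2 : ℕ))) ?_ ?_
        · intro q hq
          rw [Finset.mem_coe, Finset.mem_filter, fermionRectTorusGraph_adj_iff] at hq
          simp only [Finset.coe_insert, Finset.coe_singleton, Set.mem_insert_iff,
            Set.mem_singleton_iff, Prod.mk.injEq]
          rcases hq.2 with ⟨h2, -, h | h⟩ | ⟨h1, -, h | h⟩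
          · exact Or.inl ⟨h.symm, by rw [hy, h2]⟩
          · exact Or.inr (Or.inl ⟨eq_mod_of_succ_mod_eq (ofLex p).1.isLt (ofLex q).1.isLt h,
              by rw [hy, h2]⟩)
          · exact Or.inr (Or.inr (Or.inl ⟨by rw [hx, h1], h.symm⟩))
          · exact Or.inr (Or.inr (Or.inr ⟨by rw [hx, h1],
              eq_mod_of_succ_mod_eq (ofLex p).2.isLt (ofLex q).2.isLt h⟩))
        · intro q _ q' _ h
          simp only [Prod.mk.injEq] at h
          exact ofLex.injective (Prod.ext (Fin.ext h.1) (Fin.ext h.2))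
    _ ≤ 4 := Finset.card_le_four

/-- The ordered adjacent pairs of `ℤ/aℤ × ℤ/bℤ` number at most `4ab`. [folklore] -/
theorem card_filter_fermionRectTorusGraph_adj_pair_le (a b : ℕ) :
    #{pq : (Fin a ×ₗ Fin b) × (Fin a ×ₗ Fin b) | (fermionRectTorusGraph a b).Adj pq.1 pq.2} ≤
      4 * (a * b) := by
  calc #{pq : (Fin a ×ₗ Fin b) × (Fin a ×ₗ Fin b) | (fermionRectTorusGraph a b).Adj pq.1 pq.2}
      = ∑ p : Fin a ×ₗ Fin b, #{q | (fermionRectTorusGraph a b).Adj p q} := by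
        rw [← Finset.card_sigma]
        refine Finset.card_bij' (fun pq _ => ⟨pq.1, pq.2⟩) (fun q _ => (q.1, q.2)) ?_ ?_ ?_ ?_
        · intro pq hpq; simpa using hpq
        · intro q hq; simpa using hq
        · intro _ _; rfl
        · intro _ _; rfl
    _ ≤ ∑ _p : Fin a ×ₗ Fin b, 4 := Finset.sum_le_sum fun p _ =>
        card_filter_fermionRectTorusGraph_adj_le a b p
    _ = 4 * (a * b) := by
        rw [Finset.sum_const, Finset.card_univ, smul_eq_mul, mul_comm, card_rectSites]

section Bounds

variable {Λ : Type*} [LinearOrder Λ] [Fintype Λ] (G : SimpleGraph Λ) [DecidableRel G.Adj]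

/-- The hopping sum of a unit vector is bounded by twice the number of ordered bonds. [folklore] -/
theorem norm_hoppingSum_le {ψ : Fock (Orb Λ)} (hψ1 : star ψ ⬝ᵥ ψ = 1) {P : ℕ}
    (hP : #{pq : Λ × Λ | G.Adj pq.1 pq.2} ≤ P) :
    ‖∑ x, ∑ y, ∑ σ : Fin 2, (if G.Adj x y then
        star (annihilation (orb x σ) *ᵥ ψ) ⬝ᵥ (annihilation (orb y σ) *ᵥ ψ) else 0)‖ ≤ 2 * P := by
  calc _ ≤ ∑ x, ‖∑ y, ∑ σ : Fin 2, (if G.Adj x y then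
            star (annihilation (orb x σ) *ᵥ ψ) ⬝ᵥ (annihilation (orb y σ) *ᵥ ψ) else 0)‖ :=
          norm_sum_le _ _
      _ ≤ ∑ x, ∑ y, ‖∑ σ : Fin 2, (if G.Adj x y then
            star (annihilation (orb x σ) *ᵥ ψ) ⬝ᵥ (annihilation (orb y σ) *ᵥ ψ) else 0)‖ :=
          Finset.sum_le_sum fun x _ => norm_sum_le _ _
      _ ≤ ∑ x, ∑ y, (if G.Adj x y then (2 : ℝ) else 0) := by
          refine Finset.sum_le_sum fun x _ => Finset.sum_le_sum fun y _ => ?_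
          split_ifs with h
          · calc _ ≤ ∑ σ : Fin 2, ‖star (annihilation (orb x σ) *ᵥ ψ) ⬝ᵥ
                    (annihilation (orb y σ) *ᵥ ψ)‖ := norm_sum_le _ _
              _ ≤ ∑ _σ : Fin 2, (1 : ℝ) := Finset.sum_le_sum fun σ _ =>
                    norm_dotProduct_annihilation_le_one hψ1 _ _
              _ = 2 := by simp
          · simp
      _ = 2 * #{pq : Λ × Λ | G.Adj pq.1 pq.2} := by
          rw [← Fintype.sum_prod_type' (f := fun x y => if G.Adj x y then (2 : ℝ) else 0)]
          rw [← Finset.sum_boole, Finset.mul_sum]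
          exact Finset.sum_congr rfl fun pq _ => by split_ifs <;> simp
      _ ≤ 2 * P := by exact_mod_cast Nat.mul_le_mul_left 2 hP

/-- **A priori bounds on the sector energies.** On a graph with at most `P` ordered bonds and
`U ≥ 0`: `-2|t| P ≤ E_G(N) ≤ 2|t| P + U |Λ|` for every nonempty sector `N ≤ 2|Λ|`. [folklore] -/
theorem groundEnergyAt_mem_Icc (t : ℝ) {U : ℝ} (hU : 0 ≤ U) {P : ℕ}
    (hP : #{pq : Λ × Λ | G.Adj pq.1 pq.2} ≤ P) {N : ℕ} (hN : N ≤ 2 * Fintype.card Λ) :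
    groundEnergyAt G t U N ∈ Set.Icc (-(2 * |t| * P)) (2 * |t| * P + U * Fintype.card Λ) := by
  have hc : N ≤ Fintype.card (Orb Λ) := by rwa [card_orb]
  -- the energy of every unit vector lies in the interval
  have key : ∀ ψ : Fock (Orb Λ), star ψ ⬝ᵥ ψ = 1 →
      (expect (hamiltonian G t U) ψ).re ∈ Set.Icc (-(2 * |t| * P)) (2 * |t| * P + U * Fintype.card Λ) := by
    intro ψ hψ1
    unfold QuantumLattice.expect
    rw [dotProduct_hamiltonian_mulVec, Complex.add_re]
    set A : ℂ := ∑ x, ∑ y, ∑ σ : Fin 2, (if G.Adj x y then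
        star (annihilation (orb x σ) *ᵥ ψ) ⬝ᵥ (annihilation (orb y σ) *ᵥ ψ) else 0) with hA
    have hAn : ‖A‖ ≤ 2 * P := norm_hoppingSum_le G hψ1 hP
    have h2 : |(-(t : ℂ) * A).re| ≤ |t| * ‖A‖ :=
      (Complex.abs_re_le_norm _).trans_eq (by rw [norm_mul, norm_neg, Complex.norm_real,
        Real.norm_eq_abs])
    have h3 : |t| * ‖A‖ ≤ |t| * (2 * P) := mul_le_mul_of_nonneg_left hAn (abs_nonneg t)
    have h4 := neg_le_of_abs_le h2
    have h4' := le_of_abs_le h2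
    have hD0 : 0 ≤ ((U : ℂ) * ∑ x, star ψ ⬝ᵥ (numberOp x 0 *ᵥ (numberOp x 1 *ᵥ ψ))).re := by
      rw [Complex.re_ofReal_mul, Complex.re_sum]
      exact mul_nonneg hU (Finset.sum_nonneg fun x _ => re_dotProduct_numberOp_numberOp_nonneg ψ x)
    have hD1 : ((U : ℂ) * ∑ x, star ψ ⬝ᵥ (numberOp x 0 *ᵥ (numberOp x 1 *ᵥ ψ))).re ≤
        U * Fintype.card Λ := by
      rw [Complex.re_ofReal_mul, Complex.re_sum]
      refine mul_le_mul_of_nonneg_left ?_ hU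
      calc ∑ x, (star ψ ⬝ᵥ (numberOp x 0 *ᵥ (numberOp x 1 *ᵥ ψ))).re
          ≤ ∑ _x : Λ, (1 : ℝ) := Finset.sum_le_sum fun x _ =>
            (re_dotProduct_numberOp_numberOp_le ψ x).trans (by rw [hψ1, Complex.one_re])
        _ = Fintype.card Λ := by simp
    constructor <;> linarith
  constructor
  · refine le_csInf (groundEnergySet_nonempty _ hc) ?_
    rintro E ⟨ψ, -, hψ1, rfl⟩
    exact (key ψ hψ1).1
  · obtain ⟨E, ⟨ψ, hψN, hψ1, rfl⟩⟩ := groundEnergySet_nonempty (hamiltonian G t U) hc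
    exact (groundEnergy_le_re_expect _ hψN hψ1).trans (key ψ hψ1).2

end Bounds

/-- On `ℤ/aℤ × ℤ/bℤ` with `U ≥ 0`: `-8|t| ab ≤ E(N) ≤ (8|t| + U) ab`. [folklore] -/
theorem groundEnergyAt_rect_mem_Icc (a b : ℕ) (t : ℝ) {U : ℝ} (hU : 0 ≤ U) {N : ℕ}
    (hN : N ≤ 2 * (a * b)) :
    groundEnergyAt (fermionRectTorusGraph a b) t U N ∈
      Set.Icc (-(8 * |t| * (a * b))) ((8 * |t| + U) * (a * b)) := by
  have h := groundEnergyAt_mem_Icc (fermionRectTorusGraph a b) t hU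
    (card_filter_fermionRectTorusGraph_adj_pair_le a b) (N := N) (by rwa [card_rectSites])
  rw [card_rectSites] at h
  push_cast at h
  constructor <;> nlinarith [h.1, h.2, abs_nonneg t]

/-! ### Tiling: strips and squares -/

/-- **Strips.** Cutting `ℤ/(k+1)Mℤ × ℤ/bℤ` into `k+1` copies of `ℤ/Mℤ × ℤ/bℤ` (with arbitrary
particle numbers `N_i ≤ 2Mb` in the blocks) costs at most `8|t| b` per cut. [folklore] -/
theorem groundEnergyAt_rect_strip (M b : ℕ) (t U : ℝ) :
    ∀ (k : ℕ) (Ns : Fin (k + 1) → ℕ), (∀ i, Ns i ≤ 2 * (M * b)) →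
      groundEnergyAt (fermionRectTorusGraph ((k + 1) * M) b) t U (∑ i, Ns i) ≤
        ∑ i, groundEnergyAt (fermionRectTorusGraph M b) t U (Ns i) + 8 * |t| * b * k := by
  intro k
  induction k with
  | zero =>
      intro Ns _
      rw [show (0 + 1) * M = M by ring, Fin.sum_univ_one, Fin.sum_univ_one]
      simp
  | succ k ih =>
      intro Ns hNs
      have eN : ∑ i, Ns i = ∑ i : Fin (k + 1), Ns (Fin.castSucc i) + Ns (Fin.last _) :=
        Fin.sum_univ_castSucc _
      have eE : ∑ i, groundEnergyAt (fermionRectTorusGraph M b) t U (Ns i) =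
          ∑ i : Fin (k + 1), groundEnergyAt (fermionRectTorusGraph M b) t U (Ns (Fin.castSucc i)) +
            groundEnergyAt (fermionRectTorusGraph M b) t U (Ns (Fin.last _)) :=
        Fin.sum_univ_castSucc _
      rw [show (k + 1 + 1) * M = (k + 1) * M + M by ring, eN, eE]
      have h1 : ∑ i : Fin (k + 1), Ns (Fin.castSucc i) ≤ 2 * ((k + 1) * M * b) := by
        calc ∑ i : Fin (k + 1), Ns (Fin.castSucc i) ≤ ∑ _i : Fin (k + 1), 2 * (M * b) :=
              Finset.sum_le_sum fun i _ => hNs _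
          _ = 2 * ((k + 1) * M * b) := by
              rw [Finset.sum_const, Finset.card_univ, Fintype.card_fin, smul_eq_mul]; ring
      have hcut := groundEnergyAt_rect_cut ((k + 1) * M) M b t U h1 (hNs (Fin.last _))
      have hih := ih (fun i => Ns (Fin.castSucc i)) (fun i => hNs _)
      push_cast at hcut hih ⊢
      linarith

/-- **Squares.** Tiling `ℤ/(k+1)Mℤ × ℤ/(k+1)Mℤ` by `(k+1)²` copies of `ℤ/Mℤ × ℤ/Mℤ` with particle
numbers `N_{ij} ≤ 2M²`: `E_{(k+1)M}(Σ N_{ij}) ≤ Σ E_M(N_{ij}) + 16|t| M k (k+1)` (strips in the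
major direction, the coordinate swap, strips again). (Ruelle (1969) §2.2.) [folklore] -/
theorem groundEnergyAt_square_tiling (M : ℕ) (t U : ℝ) (k : ℕ) (Ns : Fin (k + 1) → Fin (k + 1) → ℕ)
    (hNs : ∀ i j, Ns i j ≤ 2 * (M * M)) :
    groundEnergyAt (fermionRectTorusGraph ((k + 1) * M) ((k + 1) * M)) t U (∑ i, ∑ j, Ns i j) ≤
      ∑ i, ∑ j, groundEnergyAt (fermionRectTorusGraph M M) t U (Ns i j) +
        16 * |t| * M * k * (k + 1) := by
  -- strips in the major direction, blocks `M × (k+1)M`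
  have hS : ∀ i, ∑ j, Ns i j ≤ 2 * (M * ((k + 1) * M)) := by
    intro i
    calc ∑ j, Ns i j ≤ ∑ _j : Fin (k + 1), 2 * (M * M) := Finset.sum_le_sum fun j _ => hNs i j
      _ = 2 * (M * ((k + 1) * M)) := by
          rw [Finset.sum_const, Finset.card_univ, Fintype.card_fin, smul_eq_mul]; ring
  have h1 := groundEnergyAt_rect_strip M ((k + 1) * M) t U k (fun i => ∑ j, Ns i j) hS
  -- each strip: swap, then strips again
  have h2 : ∀ i, groundEnergyAt (fermionRectTorusGraph M ((k + 1) * M)) t U (∑ j, Ns i j) ≤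
      ∑ j, groundEnergyAt (fermionRectTorusGraph M M) t U (Ns i j) + 8 * |t| * M * k := by
    intro i
    rw [← groundEnergyAt_rect_swap]
    exact groundEnergyAt_rect_strip M M t U k (Ns i) (hNs i)
  have h3 : ∑ i, groundEnergyAt (fermionRectTorusGraph M ((k + 1) * M)) t U (∑ j, Ns i j) ≤
      ∑ i, (∑ j, groundEnergyAt (fermionRectTorusGraph M M) t U (Ns i j) + 8 * |t| * M * k) :=
    Finset.sum_le_sum fun i _ => h2 i
  rw [Finset.sum_add_distrib, Finset.sum_const, Finset.card_univ, Fintype.card_fin,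
    nsmul_eq_mul] at h3
  push_cast at h1 h3 ⊢
  nlinarith [h1, h3, abs_nonneg t]

/-! ### Filling the complement of a square in a bigger square -/

/-- **Monotonicity up to the complement.** For `U ≥ 0`, a trial state of the big torus
`ℤ/(ℓ+r)ℤ × ℤ/(ℓ+r)ℤ` made of a state of the corner torus `ℓ × ℓ` and arbitrary states of the two
complementary rectangles `r × ℓ`, `r × (ℓ+r)` carrying `N_B ≤ 2((ℓ+r)² - ℓ²)` particles:
`E_{ℓ+r}(N + N_B) ≤ E_ℓ(N) + (8|t| + U)((ℓ+r)² - ℓ²) + 8|t|(2ℓ + r)`. [folklore] -/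
theorem groundEnergyAt_square_fill (ℓ r : ℕ) (t : ℝ) {U : ℝ} (hU : 0 ≤ U) {N NB : ℕ}
    (hN : N ≤ 2 * (ℓ * ℓ)) (hNB : NB ≤ 2 * (r * ℓ + r * (ℓ + r))) :
    groundEnergyAt (fermionRectTorusGraph (ℓ + r) (ℓ + r)) t U (N + NB) ≤
      groundEnergyAt (fermionRectTorusGraph ℓ ℓ) t U N +
        (8 * |t| + U) * (r * ℓ + r * (ℓ + r)) + 8 * |t| * (2 * ℓ + r) := by
  -- split the extra particles between the two rectangles
  set N₁ : ℕ := min NB (2 * (r * ℓ)) with hN₁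
  set N₂ : ℕ := NB - N₁ with hN₂
  have hN₁le : N₁ ≤ 2 * (r * ℓ) := min_le_right _ _
  have hN₁le' : N₁ ≤ NB := min_le_left _ _
  have hNB' : NB = N₁ + N₂ := by omega
  have hN₂le : N₂ ≤ 2 * (r * (ℓ + r)) := by
    rcases le_total NB (2 * (r * ℓ)) with h | h
    · have : N₁ = NB := min_eq_left h
      omega
    · have : N₁ = 2 * (r * ℓ) := min_eq_right h
      omega
  -- big cut along the major direction: blocks `ℓ × (ℓ+r)` and `r × (ℓ+r)`
  have hA : N + N₁ ≤ 2 * (ℓ * (ℓ + r)) := by nlinarith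
  have hcut1 := groundEnergyAt_rect_cut ℓ r (ℓ + r) t U hA hN₂le
  -- the first block: swap and cut again into `ℓ × ℓ` and `r × ℓ`
  have hcut2 := groundEnergyAt_rect_cut ℓ r ℓ t U hN hN₁le
  rw [groundEnergyAt_rect_swap] at hcut2
  -- crude bounds on the two rectangles
  have hB1 := (groundEnergyAt_rect_mem_Icc r ℓ t hU hN₁le).2
  have hB2 := (groundEnergyAt_rect_mem_Icc r (ℓ + r) t hU hN₂le).2
  rw [hNB', ← add_assoc]
  push_cast at hcut1 hcut2 hB1 hB2 ⊢
  nlinarith [hcut1, hcut2, hB1, hB2, abs_nonneg t]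

end ThermodynamicLimit

end Literature.MathematicalPhysics.QuantumLattice
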